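import Summits.QuantumFields.YangMills.Theses.BalabanUVNodes
import Summits.QuantumFields.YangMills.Theorems.BalabanUVNodesN27AtSpineReadingOfRecord13CoPHV

/-!
# ★ V EDITION (dag-n20-d `Thm/BalabanUVNodesSpineReadingOfRecord13CoPHV` p590105 ✓ 00:36Z 2026-08-28: `crOfRecord₁₃VAt K₀ jcut sh` ∕ `crOfRecord₁₃V`, the reading of record WITH THE PHYSICAL
# VOLUME LETTER `vol := F.side ^ 4` — «the RECORD pointer is the V edition; the v3 re-point of `PinnedAtLive` is this one token», pub-ymgap INBOX l.25713) = the token image of this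
# lineage's v1.0-reading module under `crOfRecord₁₃At ↦ crOfRecord₁₃VAt`, `NE7.Core 1 1 ↦ NE7.Core 1 (F.side ^ 4)` (the witness form of the N19′ edge), face lemmas `…_crOfRecord₁₃At ↦ …VAt`;
# every carrier but `vol`∕`δ` is shared by `rfl` (`crOfRecord₁₃VAt_T_eq`); statements and proofs otherwise VERBATIM; the v1.0 module stays as landed.
# BalabanUVNodes ∕ N27 = binder B5 AT THE RECORD, leaf H — K3⁷ `Theses.BalabanUVNodes.SpineGivenEndpointR13SepCoPH` WITH THE SPINE READING PINNED AT dag-n20-d's `crOfRecord₁₃VAt K₀ jcut sh`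
# ON THE LIVE-SELECTOR LINE (the K3⁷ skeleton v2's `PinnedAtLive`, registered 00:03Z 2026-08-28, sha16 145a664ea9c38a7b) AND A FREE READING `cr'` OFF IT: module (U)
# `…N27AtSpineReadingOfRecord13CoPHV` §3 (live part: K5 slots in the definer's currency — keyed `RelWeightBound`∕`ShellWeightBound`∕`NE7.Core ∧ Summable` WITNESSES at
# `classSet₁₃ ∕ weightA₁₃ ∕ weightB₁₃ ∕ badClass₁₃ ∕ sh`, extraction = `keyedExtraction_crOfRecord₁₃VAt` under the laws `hU hζm hζ0`, the selector pin READ OFF THE LINE) + (P) `…KeyedCore`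
# ∕ (Q) `…Holder` (off-live part: leaf D's ∕ leaf E's `cr`-parametric K5 binders at `cr'`), joined by U `spine_rec13CCoPHOn_of_split`; at `N = 2`, `Rg :=` the item's guard
# `θ.ZhUnity F 2 ∧ θ.SlotsNondegenerate₁₃ F 2`, through XXXVIᶜᵒᵖᴴ `spine_rec13CCoPHOn_iff_forall_guarded` and `hc := hP.toCore`; an eighth route-facing leaf, nothing may import it
# (cell `pub-ymgap`, HUMAN RULING D-0062 Track A, R134 seat `pub-ymgap-dag-n27-c` (s2) gen 11; `--kind proof --supports stmt-QuantumFields-20544 --as helper`; COUNT-NEUTRAL)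

WHY THE SPLIT (plan g79 Q-SEL, pub-ymgap INBOX l.25357): the datum of record reads the tuple's residual selector `θ.ppSel`, and neither `Provisos₁₃CoPH` nor the item's guard pins it to the
live selector; Bałaban's class decomposition E1∕E2 at `crOfRecord₁₃` is dag-n20-d's THEOREM exactly on the live line (`hsel`).  K3⁷ ranges over EVERY guarded admissible tuple, so «`cr :=
crOfRecord₁₃` everywhere» would ask E1∕E2 where no theorem supports them — v2's stub 2 therefore keeps `∃ cr` with `PinnedAtLive`.  This leaf displays exactly that: the reading of record
on the live line, any `cr'` with leaf D's four keyed faces off it (whether off-line tuples exist at all, or are excluded by a later record edition, is Q-SEL — not decided here).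

WHAT IS KERNEL-CHECKED ([bookkeeping]; TWO theorems, 0 `def`, 0 `sorry`):
* ★★ `spineGivenEndpointR13SepCoPH_of_liveCrOfRecord₁₃VAt_offLive_keyedFacesP : … → SpineGivenEndpointR13SepCoPH` — THE ITEM from: an ARBITRARY rates predicate `P` at a keyed rate reading
  `rr` on the whole guard (`hrates`); ON THE LIVE LINE the laws `hU hζm hζ0`, keyed N20 ∕ N21 witnesses at the reading's carriers (`h20 h21`) and the N19′ edge from `P` to a summable-core
  witness (`h19`); OFF THE LIVE LINE leaf D's binders at `cr'` (`h20' h21' hx' h19'`).  = the v2 composition's output shape, split along `LiveSel`.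
* ★★ `spineGivenEndpointR13SepCoPH_of_liveCrOfRecord₁₃VAt_offLive_homes_holder` — the same with the K4 side as the five SENTENCES + `S_D4` at dag-n22-e's guard-of-record home
  `RRec₁₃CoPHOn 𝔯 (guard)` of ANY Stage-13 rate reading (N16 at exponent `β`, N17 glued; restricted to each part by `rRec₁₃CoPHOn_mono`) and the N19′ edges reading `∀ k, RatesHolderAt … β`.

HONEST FRAMING.  NOT a discharge: terms of the item's type under displayed hypotheses (audit `proof.conditional`), every one inhabited for no family today (K0⁷ `Record13SepCoPHInhabited`
OPEN): the rates ∕ K4 sentences, the keyed N20 ∕ N21 ∕ N19′ WITNESSES on the live line (dag-n20-w1 ∕ dag-n21 ∕ dag-n19 lanes' targets), the laws `LocalBgMeasurable ∕ ZetaMeasurable ∕ 0 ≤ ζ`,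
leaf D's four faces at `cr'` off the live line; the shell split `sh` is NOT inhabited (NODE O); `jcut` unpinned; NE7 ∕ NE7b ∕ NE7c ∕ NE1′–NE9 NOT PRINTED for d = 4 and NOT PROVED at
Bałaban's objects; nothing of Bałaban's asserted or instantiated; N27 COMPOSITE, NOT discharged; K3⁷ NOT claimed closed; route rev 25 and the skeleton of record UNTOUCHED (its composition
is leaf D `_of_keyedFacesP`; this leaf is the `PinnedAtLive`-shaped sibling); counts UNMOVED (typed 28∕28 · discharged 5∕27, A 5∕28); one finite four-torus programme at fixed `ε` — NOT
ℝ⁴, NOT infinite volume, NOT OS, NOT a mass gap, NOT Clay.  No decl below carries a cite tag.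
-/

set_option autoImplicit false

namespace Summit.QuantumFields.YangMills.Theorems.BalabanUVNodesN27SpineRecord

open scoped BigOperators
open Literature.MathematicalPhysics.QuantumFieldTheory.Balaban1983to89
open Literature.MathematicalPhysics.QuantumFieldTheory.Balaban1983to89.T4Continuum
open Literature.MathematicalPhysics.QuantumFieldTheory.Balaban1983to89.Node00
open T4WeightBudget (RelWeightBound)
open T4IndicatorShell (ShellWeightBound)
open T4ContinuumYM4Torus (ForSmallCouplings)
open Summit.QuantumFields.BalabanUV.T4Continuum.Spine
open Summit.QuantumFields.YangMills.Theses.BalabanUVNodes (SpineGivenEndpointR13SepCoPH)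
open YMDAG.UVSplit
open Summit.QuantumFields.YangMills.BalabanUVNodes.N19TargetClassWeightsE1Keyed
open Summit.QuantumFields.YangMills.BalabanUVNodes.N16HolderDefs (S_N16Holder)
open Summit.QuantumFields.YangMills.BalabanUVNodes.SpineRatesHolder (RatesHolderAt)

variable (K₀ : ℕ) (jcut : ℕ → ℕ) (sh : ShellSplit₁₃CoPH 2 K₀)
  (cr' : (F : T4Family) → (θ : Stage13HParams F 2) → θ.Provisos₁₃CoPH F 2 → (ℕ → ℝ) → List (ULoop F) → SpineCarriers)

/-! ## §1 Arbitrary rates predicate `P`: the reading of record on the live line, leaf D's faces at `cr'` off it -/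

section KeyedP

variable (rr : (F : T4Family) → (θ : Stage13HParams F 2) → θ.Provisos₁₃CoPH F 2 → (ℕ → ℝ) → List (ULoop F) → RateCarriers 2)
  (P : ∀ {F : T4Family}, Datum F 2 → RateCarriers 2 → Prop)

/-- ★★ **K3⁷ WITH THE SPINE READING PINNED AT `crOfRecord₁₃VAt K₀ jcut sh` ON THE LIVE-SELECTOR LINE AND FREE (`cr'`) OFF IT, ARBITRARY RATES PREDICATE `P`** (`N = 2`; U §3
`spine_rec13CCoPHOn_live_at_crOfRecord₁₃VAt_of_keyedFacesP` on `guard ∧ LiveSel`, (P) `spine_rec13CCoPHOn_of_keyedFacesP` at `cr'` on `guard ∧ ¬LiveSel`, U `spine_rec13CCoPHOn_of_split`,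
`hc := hP.toCore`).  NOT a discharge: a term of the item's type under displayed hypotheses, each inhabited for no family today. [bookkeeping] -/
theorem spineGivenEndpointR13SepCoPH_of_liveCrOfRecord₁₃VAt_offLive_keyedFacesP
    (hrates : ∀ (F : T4Family) (θ : Stage13HParams F 2) (hP : θ.Provisos₁₃CoPH F 2), (θ.ZhUnity F 2 ∧ θ.SlotsNondegenerate₁₃ F 2) → θ.Admissible F 2 → ∀ (g₀ : ℕ → ℝ) (os : List (ULoop F)),
      P (datumOfRecord₁₃CoPH F 2 θ hP) (rr F θ hP g₀ os))
    (hU : ∀ (F : T4Family) (θ : Stage13HParams F 2), θ.Provisos₁₃CoPH F 2 → ((θ.ZhUnity F 2 ∧ θ.SlotsNondegenerate₁₃ F 2) ∧ θ.ppSel = ppSelLiveOfRecord F 2 θ.ν θ.τ9 (EOfRecord₁₃ F 2 θ.toStage13Params) (wOfRecord₉ F 2 θ.toStage9Params)) → θ.Admissible F 2 → LocalBgMeasurable F 2 θ.ν)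
    (hζm : ∀ (F : T4Family) (θ : Stage13HParams F 2), θ.Provisos₁₃CoPH F 2 → ((θ.ZhUnity F 2 ∧ θ.SlotsNondegenerate₁₃ F 2) ∧ θ.ppSel = ppSelLiveOfRecord F 2 θ.ν θ.τ9 (EOfRecord₁₃ F 2 θ.toStage13Params) (wOfRecord₉ F 2 θ.toStage9Params)) → θ.Admissible F 2 → ZetaMeasurable F 2 θ.ζ)
    (hζ0 : ∀ (F : T4Family) (θ : Stage13HParams F 2), θ.Provisos₁₃CoPH F 2 → ((θ.ZhUnity F 2 ∧ θ.SlotsNondegenerate₁₃ F 2) ∧ θ.ppSel = ppSelLiveOfRecord F 2 θ.ν θ.τ9 (EOfRecord₁₃ F 2 θ.toStage13Params) (wOfRecord₉ F 2 θ.toStage9Params)) → θ.Admissible F 2 →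
      ∀ p g k s Pl Ql RS U V', 0 ≤ θ.ζ p g k s Pl Ql RS U V')
    (h20 : ∀ (F : T4Family) (θ : Stage13HParams F 2) (hP : θ.Provisos₁₃CoPH F 2), ((θ.ZhUnity F 2 ∧ θ.SlotsNondegenerate₁₃ F 2) ∧ θ.ppSel = ppSelLiveOfRecord F 2 θ.ν θ.τ9 (EOfRecord₁₃ F 2 θ.toStage13Params) (wOfRecord₉ F 2 θ.toStage9Params)) → θ.Admissible F 2 → ∀ (g₀ : ℕ → ℝ) (os : List (ULoop F)),
      ∃ W : ℕ → ℝ, RelWeightBound 1 (classSet₁₃ θ K₀ g₀) (weightA₁₃ θ hP K₀ g₀ os) (weightB₁₃ θ hP K₀ g₀ os) (badClass₁₃ θ K₀ g₀ jcut) W)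
    (h21 : ∀ (F : T4Family) (θ : Stage13HParams F 2) (hP : θ.Provisos₁₃CoPH F 2), ((θ.ZhUnity F 2 ∧ θ.SlotsNondegenerate₁₃ F 2) ∧ θ.ppSel = ppSelLiveOfRecord F 2 θ.ν θ.τ9 (EOfRecord₁₃ F 2 θ.toStage13Params) (wOfRecord₉ F 2 θ.toStage9Params)) → θ.Admissible F 2 → ∀ (g₀ : ℕ → ℝ) (os : List (ULoop F)),
      ∃ Wsh : ℕ → ℝ, ShellWeightBound 1 (classSet₁₃ θ K₀ g₀) (weightA₁₃ θ hP K₀ g₀ os) (weightB₁₃ θ hP K₀ g₀ os) (sh F θ hP g₀ os).1 (sh F θ hP g₀ os).2 Wsh)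
    (h19 : ∀ (F : T4Family) (θ : Stage13HParams F 2) (hP : θ.Provisos₁₃CoPH F 2), ((θ.ZhUnity F 2 ∧ θ.SlotsNondegenerate₁₃ F 2) ∧ θ.ppSel = ppSelLiveOfRecord F 2 θ.ν θ.τ9 (EOfRecord₁₃ F 2 θ.toStage13Params) (wOfRecord₉ F 2 θ.toStage9Params)) → θ.Admissible F 2 → ∀ (g₀ : ℕ → ℝ) (os : List (ULoop F)),
      P (datumOfRecord₁₃CoPH F 2 θ hP) (rr F θ hP g₀ os) → letI : DecidableEq (Σ K, SiteSeqKey F (K₀ + K)) := Classical.decEq _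
        ∃ δ : ℕ → ℝ, NE7.Core 1 (F.side ^ 4) (classSet₁₃ θ K₀ g₀) (badClass₁₃ θ K₀ g₀ jcut) (fun K t x => weightA₁₃ θ hP K₀ g₀ os K t x - (sh F θ hP g₀ os).1 K t x)
          (fun K t x => weightB₁₃ θ hP K₀ g₀ os K t x - (sh F θ hP g₀ os).2 K t x) δ ∧ Summable δ)
    (h20' : ∀ (F : T4Family) (θ : Stage13HParams F 2) (hP : θ.Provisos₁₃CoPH F 2), ((θ.ZhUnity F 2 ∧ θ.SlotsNondegenerate₁₃ F 2) ∧ ¬ θ.ppSel = ppSelLiveOfRecord F 2 θ.ν θ.τ9 (EOfRecord₁₃ F 2 θ.toStage13Params) (wOfRecord₉ F 2 θ.toStage9Params)) → θ.Admissible F 2 → ∀ (g₀ : ℕ → ℝ) (os : List (ULoop F)),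
      RelWeightBound (cr' F θ hP g₀ os).l₀ (cr' F θ hP g₀ os).T (cr' F θ hP g₀ os).A (cr' F θ hP g₀ os).B (cr' F θ hP g₀ os).Bad (cr' F θ hP g₀ os).W)
    (h21' : ∀ (F : T4Family) (θ : Stage13HParams F 2) (hP : θ.Provisos₁₃CoPH F 2), ((θ.ZhUnity F 2 ∧ θ.SlotsNondegenerate₁₃ F 2) ∧ ¬ θ.ppSel = ppSelLiveOfRecord F 2 θ.ν θ.τ9 (EOfRecord₁₃ F 2 θ.toStage13Params) (wOfRecord₉ F 2 θ.toStage9Params)) → θ.Admissible F 2 → ∀ (g₀ : ℕ → ℝ) (os : List (ULoop F)),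
      ShellWeightBound (cr' F θ hP g₀ os).l₀ (cr' F θ hP g₀ os).T (cr' F θ hP g₀ os).A (cr' F θ hP g₀ os).B (cr' F θ hP g₀ os).shA (cr' F θ hP g₀ os).shB
        (cr' F θ hP g₀ os).Wsh)
    (hx' : ∀ (F : T4Family) (θ : Stage13HParams F 2) (hP : θ.Provisos₁₃CoPH F 2), ((θ.ZhUnity F 2 ∧ θ.SlotsNondegenerate₁₃ F 2) ∧ ¬ θ.ppSel = ppSelLiveOfRecord F 2 θ.ν θ.τ9 (EOfRecord₁₃ F 2 θ.toStage13Params) (wOfRecord₉ F 2 θ.toStage9Params)) → θ.Admissible F 2 →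
      B16.EndStatementBPrinted (datumOfRecord₁₃CoPH F 2 θ hP).C → DagBinding.EndpointExistence (datumOfRecord₁₃CoPH F 2 θ hP).C.toB12 →
        ForSmallCouplings (datumOfRecord₁₃CoPH F 2 θ hP) fun g₀ => ∀ os : List (ULoop F),
          0 < (cr' F θ hP g₀ os).l₀ ∧ 0 < (cr' F θ hP g₀ os).vol ∧
          (∀ (K : ℕ) (t : ℝ), |t| ≤ (cr' F θ hP g₀ os).l₀ →
            T4GenFunBounds.schemeZ ((datumOfRecord₁₃CoPH F 2 θ hP).scheme g₀) os ((cr' F θ hP g₀ os).K₀ + K) t =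
              ∑ τ ∈ (cr' F θ hP g₀ os).T K, (cr' F θ hP g₀ os).A K t τ) ∧
          (∀ (K : ℕ) (t : ℝ), |t| ≤ (cr' F θ hP g₀ os).l₀ →
            T4GenFunBounds.schemeZ ((datumOfRecord₁₃CoPH F 2 θ hP).scheme g₀) os ((cr' F θ hP g₀ os).K₀ + K + 1) t =
              ∑ τ ∈ (cr' F θ hP g₀ os).T K, (cr' F θ hP g₀ os).B K t τ))
    (h19' : ∀ (F : T4Family) (θ : Stage13HParams F 2) (hP : θ.Provisos₁₃CoPH F 2), ((θ.ZhUnity F 2 ∧ θ.SlotsNondegenerate₁₃ F 2) ∧ ¬ θ.ppSel = ppSelLiveOfRecord F 2 θ.ν θ.τ9 (EOfRecord₁₃ F 2 θ.toStage13Params) (wOfRecord₉ F 2 θ.toStage9Params)) → θ.Admissible F 2 → ∀ (g₀ : ℕ → ℝ) (os : List (ULoop F)),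
      P (datumOfRecord₁₃CoPH F 2 θ hP) (rr F θ hP g₀ os) → letI := (cr' F θ hP g₀ os).dec
        ∃ δ : ℕ → ℝ, NE7.Core (cr' F θ hP g₀ os).l₀ (cr' F θ hP g₀ os).vol (cr' F θ hP g₀ os).T (cr' F θ hP g₀ os).Bad
          (fun K t τ => (cr' F θ hP g₀ os).A K t τ - (cr' F θ hP g₀ os).shA K t τ) (fun K t τ => (cr' F θ hP g₀ os).B K t τ - (cr' F θ hP g₀ os).shB K t τ) δ ∧
          Summable δ) :
    SpineGivenEndpointR13SepCoPH :=
  fun F θ hP hG hθ _ _ =>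
    (spine_rec13CCoPHOn_iff_forall_guarded (fun F θ => θ.ZhUnity F 2 ∧ θ.SlotsNondegenerate₁₃ F 2)).mp
      (spine_rec13CCoPHOn_of_split (fun F θ => θ.ZhUnity F 2 ∧ θ.SlotsNondegenerate₁₃ F 2)
        (fun F (θ : Stage13HParams F 2) => θ.ppSel = ppSelLiveOfRecord F 2 θ.ν θ.τ9 (EOfRecord₁₃ F 2 θ.toStage13Params) (wOfRecord₉ F 2 θ.toStage9Params))
        (spine_rec13CCoPHOn_live_at_crOfRecord₁₃VAt_of_keyedFacesP K₀ jcut sh (fun F θ => θ.ZhUnity F 2 ∧ θ.SlotsNondegenerate₁₃ F 2) rr P hU hζm hζ0 h20 h21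
          (fun F θ hP hRg hθ => hrates F θ hP hRg.1 hθ) h19)
        (spine_rec13CCoPHOn_of_keyedFacesP (cr := cr') (rr := rr)
          (Rg := fun F θ => (θ.ZhUnity F 2 ∧ θ.SlotsNondegenerate₁₃ F 2) ∧ ¬ θ.ppSel = ppSelLiveOfRecord F 2 θ.ν θ.τ9 (EOfRecord₁₃ F 2 θ.toStage13Params) (wOfRecord₉ F 2 θ.toStage9Params)) (P := P)
          h20' h21' (fun F θ hP hRg hθ => hrates F θ hP hRg.1 hθ) h19' hx'))
      F θ hP.toCore hG hθ

end KeyedP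

/-! ## §2 The K4 side as SENTENCES at dag-n22-e's guard-of-record home of ANY Stage-13 rate reading (R-β, N17 glued) -/

section Homes

variable (β : ℝ) (𝔯 : RateReading₁₃CoPH 2)

/-- ★★ **K3⁷ FROM THE K4 SENTENCES AT `RRec₁₃CoPHOn 𝔯 (guard)` AND THE K5 SIDE AT `crOfRecord₁₃VAt K₀ jcut sh` ON THE LIVE LINE ∕ AT `cr'` OFF IT** (`N = 2`; U §3
`spine_rec13CCoPHOn_live_of_homes₁₃CoPHOn_holder_at_crOfRecord₁₃VAt` on `guard ∧ LiveSel`, (Q) §1 `spine_rec13CCoPHOn_of_homes₁₃CoPHOn_holder` at `cr'` on `guard ∧ ¬LiveSel` (N17 glued by dag-n17-a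
`s_N17_of_D4_N18`, `S_N20`∕`S_N21` sentences at `SRec₁₃CoPHOn cr' …` from the keyed forms), sentences restricted to each part by dag-n22-e `rRec₁₃CoPHOn_mono`).  ANY `𝔯`: at
`𝔯 := readingOfRecord₁₃CoPH w1 ℓ₃ ne2 ne1`, `K₀ = 0` both readings of record on the live line.  NOT a discharge; NE3 at exponent β and every other estimate NOT PROVED. [bookkeeping] -/
theorem spineGivenEndpointR13SepCoPH_of_liveCrOfRecord₁₃VAt_offLive_homes_holder
    (h14 : S_N14 (RRec₁₃CoPHOn 𝔯 (fun F θ => θ.ZhUnity F 2 ∧ θ.SlotsNondegenerate₁₃ F 2))) (h15 : S_N15 (RRec₁₃CoPHOn 𝔯 (fun F θ => θ.ZhUnity F 2 ∧ θ.SlotsNondegenerate₁₃ F 2)))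
    (h16 : S_N16Holder β (RRec₁₃CoPHOn 𝔯 (fun F θ => θ.ZhUnity F 2 ∧ θ.SlotsNondegenerate₁₃ F 2))) (h18 : S_N18 (RRec₁₃CoPHOn 𝔯 (fun F θ => θ.ZhUnity F 2 ∧ θ.SlotsNondegenerate₁₃ F 2)))
    (h22 : S_N22 (RRec₁₃CoPHOn 𝔯 (fun F θ => θ.ZhUnity F 2 ∧ θ.SlotsNondegenerate₁₃ F 2))) (hD4 : S_D4 (RRec₁₃CoPHOn 𝔯 (fun F θ => θ.ZhUnity F 2 ∧ θ.SlotsNondegenerate₁₃ F 2)))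
    (hU : ∀ (F : T4Family) (θ : Stage13HParams F 2), θ.Provisos₁₃CoPH F 2 → ((θ.ZhUnity F 2 ∧ θ.SlotsNondegenerate₁₃ F 2) ∧ θ.ppSel = ppSelLiveOfRecord F 2 θ.ν θ.τ9 (EOfRecord₁₃ F 2 θ.toStage13Params) (wOfRecord₉ F 2 θ.toStage9Params)) → θ.Admissible F 2 → LocalBgMeasurable F 2 θ.ν)
    (hζm : ∀ (F : T4Family) (θ : Stage13HParams F 2), θ.Provisos₁₃CoPH F 2 → ((θ.ZhUnity F 2 ∧ θ.SlotsNondegenerate₁₃ F 2) ∧ θ.ppSel = ppSelLiveOfRecord F 2 θ.ν θ.τ9 (EOfRecord₁₃ F 2 θ.toStage13Params) (wOfRecord₉ F 2 θ.toStage9Params)) → θ.Admissible F 2 → ZetaMeasurable F 2 θ.ζ)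
    (hζ0 : ∀ (F : T4Family) (θ : Stage13HParams F 2), θ.Provisos₁₃CoPH F 2 → ((θ.ZhUnity F 2 ∧ θ.SlotsNondegenerate₁₃ F 2) ∧ θ.ppSel = ppSelLiveOfRecord F 2 θ.ν θ.τ9 (EOfRecord₁₃ F 2 θ.toStage13Params) (wOfRecord₉ F 2 θ.toStage9Params)) → θ.Admissible F 2 →
      ∀ p g k s Pl Ql RS U V', 0 ≤ θ.ζ p g k s Pl Ql RS U V')
    (h20 : ∀ (F : T4Family) (θ : Stage13HParams F 2) (hP : θ.Provisos₁₃CoPH F 2), ((θ.ZhUnity F 2 ∧ θ.SlotsNondegenerate₁₃ F 2) ∧ θ.ppSel = ppSelLiveOfRecord F 2 θ.ν θ.τ9 (EOfRecord₁₃ F 2 θ.toStage13Params) (wOfRecord₉ F 2 θ.toStage9Params)) → θ.Admissible F 2 → ∀ (g₀ : ℕ → ℝ) (os : List (ULoop F)),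
      ∃ W : ℕ → ℝ, RelWeightBound 1 (classSet₁₃ θ K₀ g₀) (weightA₁₃ θ hP K₀ g₀ os) (weightB₁₃ θ hP K₀ g₀ os) (badClass₁₃ θ K₀ g₀ jcut) W)
    (h21 : ∀ (F : T4Family) (θ : Stage13HParams F 2) (hP : θ.Provisos₁₃CoPH F 2), ((θ.ZhUnity F 2 ∧ θ.SlotsNondegenerate₁₃ F 2) ∧ θ.ppSel = ppSelLiveOfRecord F 2 θ.ν θ.τ9 (EOfRecord₁₃ F 2 θ.toStage13Params) (wOfRecord₉ F 2 θ.toStage9Params)) → θ.Admissible F 2 → ∀ (g₀ : ℕ → ℝ) (os : List (ULoop F)),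
      ∃ Wsh : ℕ → ℝ, ShellWeightBound 1 (classSet₁₃ θ K₀ g₀) (weightA₁₃ θ hP K₀ g₀ os) (weightB₁₃ θ hP K₀ g₀ os) (sh F θ hP g₀ os).1 (sh F θ hP g₀ os).2 Wsh)
    (h19 : ∀ (F : T4Family) (θ : Stage13HParams F 2) (hP : θ.Provisos₁₃CoPH F 2), ((θ.ZhUnity F 2 ∧ θ.SlotsNondegenerate₁₃ F 2) ∧ θ.ppSel = ppSelLiveOfRecord F 2 θ.ν θ.τ9 (EOfRecord₁₃ F 2 θ.toStage13Params) (wOfRecord₉ F 2 θ.toStage9Params)) → θ.Admissible F 2 → ∀ (g₀ : ℕ → ℝ) (os : List (ULoop F)),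
      (∀ k : ℕ, RatesHolderAt (datumOfRecord₁₃CoPH F 2 θ hP) (rateCarriersOfRecord₁₃CoPH 𝔯 F θ hP g₀ os k) β) → letI : DecidableEq (Σ K, SiteSeqKey F (K₀ + K)) := Classical.decEq _
        ∃ δ : ℕ → ℝ, NE7.Core 1 (F.side ^ 4) (classSet₁₃ θ K₀ g₀) (badClass₁₃ θ K₀ g₀ jcut) (fun K t x => weightA₁₃ θ hP K₀ g₀ os K t x - (sh F θ hP g₀ os).1 K t x)
          (fun K t x => weightB₁₃ θ hP K₀ g₀ os K t x - (sh F θ hP g₀ os).2 K t x) δ ∧ Summable δ)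
    (h20' : ∀ (F : T4Family) (θ : Stage13HParams F 2) (hP : θ.Provisos₁₃CoPH F 2), ((θ.ZhUnity F 2 ∧ θ.SlotsNondegenerate₁₃ F 2) ∧ ¬ θ.ppSel = ppSelLiveOfRecord F 2 θ.ν θ.τ9 (EOfRecord₁₃ F 2 θ.toStage13Params) (wOfRecord₉ F 2 θ.toStage9Params)) → θ.Admissible F 2 → ∀ (g₀ : ℕ → ℝ) (os : List (ULoop F)),
      RelWeightBound (cr' F θ hP g₀ os).l₀ (cr' F θ hP g₀ os).T (cr' F θ hP g₀ os).A (cr' F θ hP g₀ os).B (cr' F θ hP g₀ os).Bad (cr' F θ hP g₀ os).W)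
    (h21' : ∀ (F : T4Family) (θ : Stage13HParams F 2) (hP : θ.Provisos₁₃CoPH F 2), ((θ.ZhUnity F 2 ∧ θ.SlotsNondegenerate₁₃ F 2) ∧ ¬ θ.ppSel = ppSelLiveOfRecord F 2 θ.ν θ.τ9 (EOfRecord₁₃ F 2 θ.toStage13Params) (wOfRecord₉ F 2 θ.toStage9Params)) → θ.Admissible F 2 → ∀ (g₀ : ℕ → ℝ) (os : List (ULoop F)),
      ShellWeightBound (cr' F θ hP g₀ os).l₀ (cr' F θ hP g₀ os).T (cr' F θ hP g₀ os).A (cr' F θ hP g₀ os).B (cr' F θ hP g₀ os).shA (cr' F θ hP g₀ os).shB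
        (cr' F θ hP g₀ os).Wsh)
    (hx' : ∀ (F : T4Family) (θ : Stage13HParams F 2) (hP : θ.Provisos₁₃CoPH F 2), ((θ.ZhUnity F 2 ∧ θ.SlotsNondegenerate₁₃ F 2) ∧ ¬ θ.ppSel = ppSelLiveOfRecord F 2 θ.ν θ.τ9 (EOfRecord₁₃ F 2 θ.toStage13Params) (wOfRecord₉ F 2 θ.toStage9Params)) → θ.Admissible F 2 →
      B16.EndStatementBPrinted (datumOfRecord₁₃CoPH F 2 θ hP).C → DagBinding.EndpointExistence (datumOfRecord₁₃CoPH F 2 θ hP).C.toB12 →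
        ForSmallCouplings (datumOfRecord₁₃CoPH F 2 θ hP) fun g₀ => ∀ os : List (ULoop F),
          0 < (cr' F θ hP g₀ os).l₀ ∧ 0 < (cr' F θ hP g₀ os).vol ∧
          (∀ (K : ℕ) (t : ℝ), |t| ≤ (cr' F θ hP g₀ os).l₀ →
            T4GenFunBounds.schemeZ ((datumOfRecord₁₃CoPH F 2 θ hP).scheme g₀) os ((cr' F θ hP g₀ os).K₀ + K) t =
              ∑ τ ∈ (cr' F θ hP g₀ os).T K, (cr' F θ hP g₀ os).A K t τ) ∧
          (∀ (K : ℕ) (t : ℝ), |t| ≤ (cr' F θ hP g₀ os).l₀ →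
            T4GenFunBounds.schemeZ ((datumOfRecord₁₃CoPH F 2 θ hP).scheme g₀) os ((cr' F θ hP g₀ os).K₀ + K + 1) t =
              ∑ τ ∈ (cr' F θ hP g₀ os).T K, (cr' F θ hP g₀ os).B K t τ))
    (h19' : ∀ (F : T4Family) (θ : Stage13HParams F 2) (hP : θ.Provisos₁₃CoPH F 2), ((θ.ZhUnity F 2 ∧ θ.SlotsNondegenerate₁₃ F 2) ∧ ¬ θ.ppSel = ppSelLiveOfRecord F 2 θ.ν θ.τ9 (EOfRecord₁₃ F 2 θ.toStage13Params) (wOfRecord₉ F 2 θ.toStage9Params)) → θ.Admissible F 2 → ∀ (g₀ : ℕ → ℝ) (os : List (ULoop F)),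
      (∀ k : ℕ, RatesHolderAt (datumOfRecord₁₃CoPH F 2 θ hP) (rateCarriersOfRecord₁₃CoPH 𝔯 F θ hP g₀ os k) β) → letI := (cr' F θ hP g₀ os).dec
        ∃ δ : ℕ → ℝ, NE7.Core (cr' F θ hP g₀ os).l₀ (cr' F θ hP g₀ os).vol (cr' F θ hP g₀ os).T (cr' F θ hP g₀ os).Bad
          (fun K t τ => (cr' F θ hP g₀ os).A K t τ - (cr' F θ hP g₀ os).shA K t τ) (fun K t τ => (cr' F θ hP g₀ os).B K t τ - (cr' F θ hP g₀ os).shB K t τ) δ ∧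
          Summable δ) :
    SpineGivenEndpointR13SepCoPH :=
  fun F θ hP hG hθ _ _ =>
    (spine_rec13CCoPHOn_iff_forall_guarded (fun F θ => θ.ZhUnity F 2 ∧ θ.SlotsNondegenerate₁₃ F 2)).mp
      (spine_rec13CCoPHOn_of_split (fun F θ => θ.ZhUnity F 2 ∧ θ.SlotsNondegenerate₁₃ F 2)
        (fun F (θ : Stage13HParams F 2) => θ.ppSel = ppSelLiveOfRecord F 2 θ.ν θ.τ9 (EOfRecord₁₃ F 2 θ.toStage13Params) (wOfRecord₉ F 2 θ.toStage9Params))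
        (spine_rec13CCoPHOn_live_of_homes₁₃CoPHOn_holder_at_crOfRecord₁₃VAt K₀ jcut sh (fun F θ => θ.ZhUnity F 2 ∧ θ.SlotsNondegenerate₁₃ F 2) β 𝔯
          (fun F D g₀ os R hR => h14 F D g₀ os R (rRec₁₃CoPHOn_mono 𝔯 (fun _ _ h => h.1) hR))
          (fun F D g₀ os R hR => h15 F D g₀ os R (rRec₁₃CoPHOn_mono 𝔯 (fun _ _ h => h.1) hR))
          (fun F D g₀ os R hR => h16 F D g₀ os R (rRec₁₃CoPHOn_mono 𝔯 (fun _ _ h => h.1) hR))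
          (fun F D g₀ os R hR => h18 F D g₀ os R (rRec₁₃CoPHOn_mono 𝔯 (fun _ _ h => h.1) hR))
          (fun F D g₀ os R hR => h22 F D g₀ os R (rRec₁₃CoPHOn_mono 𝔯 (fun _ _ h => h.1) hR))
          (fun F D g₀ os R hR => hD4 F D g₀ os R (rRec₁₃CoPHOn_mono 𝔯 (fun _ _ h => h.1) hR))
          hU hζm hζ0 h20 h21 h19)
        (spine_rec13CCoPHOn_of_homes₁₃CoPHOn_holder cr' β 𝔯 (fun F θ => (θ.ZhUnity F 2 ∧ θ.SlotsNondegenerate₁₃ F 2) ∧ ¬ θ.ppSel = ppSelLiveOfRecord F 2 θ.ν θ.τ9 (EOfRecord₁₃ F 2 θ.toStage13Params) (wOfRecord₉ F 2 θ.toStage9Params))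
          (fun F D g₀ os R hR => h14 F D g₀ os R (rRec₁₃CoPHOn_mono 𝔯 (fun _ _ h => h.1) hR))
          (fun F D g₀ os R hR => h15 F D g₀ os R (rRec₁₃CoPHOn_mono 𝔯 (fun _ _ h => h.1) hR))
          (fun F D g₀ os R hR => h16 F D g₀ os R (rRec₁₃CoPHOn_mono 𝔯 (fun _ _ h => h.1) hR))
          (YMDAG.N17.s_N17_of_D4_N18 _ (fun F D g₀ os R hR => hD4 F D g₀ os R (rRec₁₃CoPHOn_mono 𝔯 (fun _ _ h => h.1) hR))
            (fun F D g₀ os R hR => h18 F D g₀ os R (rRec₁₃CoPHOn_mono 𝔯 (fun _ _ h => h.1) hR)))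
          (fun F D g₀ os R hR => h18 F D g₀ os R (rRec₁₃CoPHOn_mono 𝔯 (fun _ _ h => h.1) hR))
          (fun F D g₀ os R hR => h22 F D g₀ os R (rRec₁₃CoPHOn_mono 𝔯 (fun _ _ h => h.1) hR))
          ((s_N20_sRec₁₃CoPHOn_iff cr' _).mpr h20') (by
            rintro F D g₀ os S ⟨θ, hP, hRg, hθ, -, rfl⟩
            exact h21' F θ hP hRg hθ g₀ os)
          hx' h19'))
      F θ hP.toCore hG hθ

end Homes

end Summit.QuantumFields.YangMills.Theorems.BalabanUVNodesN27SpineRecord
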